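import Literature.Analysis.FluidPDE.HolderFieldCalculus
import Mathlib.Analysis.Calculus.BumpFunction.FiniteDimension
import HarnessLib

/-!
# Cut-off profiles: uniform derivative bounds for translated bumps, and smooth products with
# fields that are regular only near the support of the cut-off

Analysis/FluidPDE support file (everything proved, no definitions, no named facts) on the proof
path of the named fact `Literature.Analysis.FluidPDE.jia_sverak_2014_local_higher_regularity`
(`JiaSverak2014LocalRegularity.lean`; H. Jia, V. Šverák, Invent. Math. 196 (2014) =
arXiv:1204.0529, §4 proof of Thm. 4.1: the bootstrapping uses a sequence of cut-offs `η` between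
shrinking balls centred at the point `x₀`, with constants independent of `x₀`, and multiplies them
with functions — the velocity, the pressure — that are regular only near the ball).

* `contDiffBump_apply_eq_bump_zero_sub` — a bump centred at `c` is the translate of the bump with
  the same radii centred at `0`; `exists_isCkBounded_contDiffBump_uniform` — **`Cᵏ` bounds for bumps
  of given radii, uniform in the centre**;
* `bumpCutoff_smul_contDiff`, `bumpCutoff_smul_continuous` — `θ • V` is smooth
  (continuous) on the whole space when `θ` is smooth (continuous) with `tsupport θ ⊆ U`, `U` open,
  and `V` is smooth (continuous) on `U` only;
* `iteratedFDeriv_smul_eq_of_eqOn_nhds` — localisation of the derivatives of such products;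
* `IsCkBounded.isHolderField_smul_of_contDiffOn_ball` — **a `C^{k+1}`-bounded cut-off supported in
  `B̄(c, R₁)` times a field smooth on `B(c, R₂) ⊋ B̄(c, R₁)` with derivative bounds on `B̄(c, R₁)`
  is a global `C^{k,α}` field** (through an intermediate bump `ψ ≡ 1` near `B̄(c, R₁)`,
  supported in `B(c, R₂)`, and `HolderFieldCalculus.IsCkBounded.isHolderField_smul_of_bounds_on`).

## Mathlib / tree search

Mathlib (used): `ContDiffBump` (`apply`, `one_of_mem_closedBall`, `support_eq`, `tsupport_eq`,
`contDiff`, `hasCompactSupport`, `eventuallyEq_one_of_mem_ball`), `notMem_tsupport_iff_eventuallyEq`,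
`Filter.EventuallyEq.iteratedFDeriv`, `contDiff_iff_contDiffAt`. Tree: `IsCkBounded`,
`IsCkBounded.comp_sub_right`, `exists_isCkBounded_of_hasCompactSupport`,
`IsCkBounded.isHolderField_smul_of_bounds_on` (`HolderFieldCalculus`).

## References

* H. Jia, V. Šverák, Invent. Math. 196 (2014) = arXiv:1204.0529, §4 proof of Thm. 4.1 and §3
  proof of Thm. 3.2 (the cut-offs `φ`, `η`). Bib key `JiaSverak2014`.
-/

noncomputable section

open Set Function Filter Metric
open _root_.Topology
open scoped NNReal ContDiff

namespace Literature.Analysis.FluidPDE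

variable {E : Type*} [NormedAddCommGroup E] [NormedSpace ℝ E]
variable {F : Type*} [NormedAddCommGroup F] [NormedSpace ℝ F]

/-! ### Translated bumps and uniform bounds -/

section Bump

variable [HasContDiffBump E]

/-- **A bump centred at `c` is the translate of the bump with the same radii centred at `0`.** [folklore] -/
theorem contDiffBump_apply_eq_bump_zero_sub {c : E} (f : ContDiffBump c) (x : E) :
    f x = ((⟨f.rIn, f.rOut, f.rIn_pos, f.rIn_lt_rOut⟩ : ContDiffBump (0 : E)) : E → ℝ) (x - c) := by
  rw [ContDiffBump.apply, ContDiffBump.apply, sub_zero]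

variable [FiniteDimensional ℝ E]

/-- **Uniform `Cᵏ` bounds for bumps of fixed radii**: for radii `0 < rIn < rOut` and every `k`
there is `Θ` such that every bump with these radii, at every centre, is `Cᵏ`-bounded by `Θ`. [folklore] -/
theorem exists_isCkBounded_contDiffBump_uniform {rIn rOut : ℝ} (h0 : 0 < rIn) (h1 : rIn < rOut)
    (k : ℕ) : ∃ Θ : ℝ, 0 ≤ Θ ∧ ∀ (c : E) (f : ContDiffBump c), f.rIn = rIn → f.rOut = rOut →
      IsCkBounded k Θ (f : E → ℝ) := by
  set g : ContDiffBump (0 : E) := ⟨rIn, rOut, h0, h1⟩ with hg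
  obtain ⟨Θ, hΘ⟩ := exists_isCkBounded_of_hasCompactSupport (a := (g : E → ℝ)) g.contDiff
    g.hasCompactSupport k
  refine ⟨Θ, hΘ.nonneg, fun c f hfIn hfOut => ?_⟩
  have hfun : (f : E → ℝ) = fun x => (g : E → ℝ) (x - c) := by
    funext x
    rw [contDiffBump_apply_eq_bump_zero_sub f]
    simp only [hg, hfIn, hfOut]
  rw [hfun]
  exact hΘ.comp_sub_right c

end Bump

/-! ### Smooth products with locally regular fields -/

omit [NormedSpace ℝ E] in
/-- **`θ • V` is continuous** when `θ` is continuous with `tsupport θ ⊆ U`, `U` open, and `V` is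
continuous on `U`. [folklore] -/
theorem bumpCutoff_smul_continuous {θ : E → ℝ} {V : E → F} {U : Set E} (hθ : Continuous θ)
    (hsupp : tsupport θ ⊆ U) (hU : IsOpen U) (hV : ContinuousOn V U) :
    Continuous fun x => θ x • V x := by
  refine continuous_iff_continuousAt.2 fun x => ?_
  by_cases hx : x ∈ U
  · exact hθ.continuousAt.smul (hV.continuousAt (hU.mem_nhds hx))
  · have hx' : x ∉ tsupport θ := fun h => hx (hsupp h)
    have h0 : θ =ᶠ[𝓝 x] 0 := notMem_tsupport_iff_eventuallyEq.1 hx'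
    have h0' : (fun y => θ y • V y) =ᶠ[𝓝 x] fun _ => 0 := by
      filter_upwards [h0] with y hy
      rw [hy, Pi.zero_apply, zero_smul]
    exact (continuousAt_const.congr h0'.symm)

/-- **`θ • V` is `C^n`** when `θ` is `C^n` with `tsupport θ ⊆ U`, `U` open, and `V` is `C^n` on `U`. [folklore] -/
theorem bumpCutoff_smul_contDiff {θ : E → ℝ} {V : E → F} {U : Set E} {n : ℕ∞}
    (hθ : ContDiff ℝ n θ) (hsupp : tsupport θ ⊆ U) (hU : IsOpen U) (hV : ContDiffOn ℝ n V U) :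
    ContDiff ℝ n fun x => θ x • V x := by
  refine contDiff_iff_contDiffAt.2 fun x => ?_
  by_cases hx : x ∈ U
  · exact hθ.contDiffAt.smul (hV.contDiffAt (hU.mem_nhds hx))
  · have hx' : x ∉ tsupport θ := fun h => hx (hsupp h)
    have h0 : θ =ᶠ[𝓝 x] 0 := notMem_tsupport_iff_eventuallyEq.1 hx'
    have h0' : (fun y => θ y • V y) =ᶠ[𝓝 x] fun _ => 0 := by
      filter_upwards [h0] with y hy
      rw [hy, Pi.zero_apply, zero_smul]
    exact (contDiffAt_const.congr_of_eventuallyEq h0')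

omit [NormedSpace ℝ E] in
/-- Products with the same cut-off of two fields agreeing near `tsupport θ` coincide. [folklore] -/
theorem bumpCutoff_smul_congr {θ : E → ℝ} {V V' : E → F} {S : Set E} (hsupp : tsupport θ ⊆ S)
    (heq : EqOn V V' S) : (fun x => θ x • V x) = fun x => θ x • V' x := by
  funext x
  by_cases hx : x ∈ tsupport θ
  · rw [heq (hsupp hx)]
  · rw [image_eq_zero_of_notMem_tsupport hx, zero_smul, zero_smul]

/-! ### The cut-off lemma for fields smooth on a ball -/

section Ball

/-- **A `C^{k+1}`-bounded cut-off supported in `B̄(c, R₁)` times a field smooth on the larger open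
ball `B(c, R₂)`, `R₁ < R₂`, with derivative bounds `‖DʲV‖ ≤ B` (`j ≤ k + 1`) on `B̄(c, R₁)`, is a
global `C^{k,α}` field with constant `2^{k+2} Θ B`** (`0 ≤ α ≤ 1`). The product is understood as the
global function `x ↦ θ(x) • V(x)`; it equals `θ • (ψ • V)` for a bump `ψ ≡ 1` near `B̄(c, R₁)`
supported in `B(c, R₂)`, where `ψ • V` is globally smooth with the derivatives of `V` on `B̄(c, R₁)`.
[folklore] -/
theorem IsCkBounded.isHolderField_smul_of_contDiffOn_ball [HasContDiffBump E] {k : ℕ} {α Θ B : ℝ}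
    {θ : E → ℝ} {V : E → F} {c : E} {R₁ R₂ : ℝ} (hθ : IsCkBounded (k + 1) Θ θ)
    (hθs : tsupport θ ⊆ closedBall c R₁) (hR₁ : 0 < R₁) (hR : R₁ < R₂)
    (hV : ContDiffOn ℝ ∞ V (ball c R₂)) (hB0 : 0 ≤ B)
    (hB : ∀ j ≤ k + 1, ∀ x ∈ closedBall c R₁, ‖iteratedFDeriv ℝ j V x‖ ≤ B) (hα0 : 0 ≤ α) (hα1 : α ≤ 1) :
    IsHolderField k α (2 ^ (k + 2) * Θ * B) fun x => θ x • V x := by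
  -- the intermediate bump
  set r₁ : ℝ := (2 * R₁ + R₂) / 3 with hr₁
  set r₂ : ℝ := (R₁ + 2 * R₂) / 3 with hr₂
  have hr₁R₁ : R₁ < r₁ := by rw [hr₁]; linarith
  have hr₁r₂ : r₁ < r₂ := by rw [hr₁, hr₂]; linarith
  have hr₂R₂ : r₂ < R₂ := by rw [hr₂]; linarith
  have hr₁0 : 0 < r₁ := hR₁.trans hr₁R₁
  set ψ : ContDiffBump c := ⟨r₁, r₂, hr₁0, hr₁r₂⟩ with hψ
  have hψs : tsupport (ψ : E → ℝ) ⊆ ball c R₂ := by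
    rw [ψ.tsupport_eq]
    exact closedBall_subset_ball hr₂R₂
  set Vt : E → F := fun x => ψ x • V x with hVt
  have hVts : ContDiff ℝ ∞ Vt := bumpCutoff_smul_contDiff ψ.contDiff hψs isOpen_ball hV
  -- `Vt = V` on the open ball `B(c, r₁) ⊃ B̄(c, R₁)`
  have hVteq : EqOn Vt V (ball c r₁) := fun x hx => by
    show ψ x • V x = V x
    rw [ψ.one_of_mem_closedBall (ball_subset_closedBall hx), one_smul]
  have hprod : (fun x => θ x • V x) = fun x => θ x • Vt x :=
    bumpCutoff_smul_congr (S := ball c r₁) (hθs.trans (closedBall_subset_ball hr₁R₁))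
      fun x hx => (hVteq hx).symm
  -- derivatives of `Vt` on `B̄(c, R₁)` are those of `V`
  have hDeq : ∀ (j : ℕ), ∀ x ∈ closedBall c R₁, iteratedFDeriv ℝ j Vt x = iteratedFDeriv ℝ j V x := by
    intro j x hx
    have hx' : x ∈ ball c r₁ := closedBall_subset_ball hr₁R₁ hx
    have hev : Vt =ᶠ[𝓝 x] V := by
      filter_upwards [isOpen_ball.mem_nhds hx'] with y hy
      exact hVteq hy
    exact (hev.iteratedFDeriv ℝ j).self_of_nhds
  have hBt : ∀ j ≤ k + 1, ∀ x ∈ closedBall c R₁, ‖iteratedFDeriv ℝ j Vt x‖ ≤ B := fun j hj x hx => by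
    rw [hDeq j x hx]; exact hB j hj x hx
  rw [hprod]
  exact hθ.isHolderField_smul_of_bounds_on hθs (contDiff_infty.1 hVts (k + 1)) hB0 hBt hα0 hα1

end Ball

end Literature.Analysis.FluidPDE

end
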